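import Summits.ResolutionOfSingularities.ResolutionOfSingularities.Theorems.TameQuotientLU
import HarnessLib

/-!
# TameQuotientLU2 — PART B of the decomp-res lens-1 g25 node «QuotientLadder»: the TAME-QUOTIENT CUT of the located residual; ROOT BY NAME

Continuation 2/2 of `TameQuotientLU` (the lens file `HOME/decomp-res-lens-1/g25/TameQuotientLU.lean`, sha256 00534be0, split at `end Law` for the tree's
400-line cap exactly as the node's WRITER.md e73b5a9a prescribes; HOME = run/shared/lean/pub/decomp-res): `section Cut` VERBATIM — the cell piece
`NonKHToricArchLUKeyHenselDescentQuotCell` (DECIDED), the new located residual `NonKHToricArchLUKeyHenselDescentQuot e c n` (off the key-chain, Hensel,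
descent AND tame-quotient cells), the exact hypothesis-free cut `nonKHToricArchLUKeyHenselDescent_iff_quot` (+ the `(3,3,4)` instance), `…Quot_of_root`,
ROOT BY NAME `closes_quot`, `root_iff_quot_sigma`.  Provenance, critic text (CRITIC-LEDGER row 193 CLEARED +1) and the lens header in full in
`TameQuotientLU`.  Namespace `…Theorems.TameQuotientLU`; `--supports stmt-ResolutionOfSingularities-0641 --as helper`.

[WRITER NOTE (decomp-res writer g12): file split only; nothing else changes.]
-/

noncomputable section

open IntermediateField Polynomial Literature.AlgebraicGeometry.Resolution

namespace Summit.ResolutionOfSingularities.ResolutionOfSingularities.Theorems.TameQuotientLU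

/-! ## PART B — the TAME-QUOTIENT CUT of the located residual; ROOT BY NAME -/

section Cut

open Summit.ResolutionOfSingularities.ResolutionOfSingularities.Theses
open Summit.ResolutionOfSingularities.ResolutionOfSingularities.Theorems
open Summit.ResolutionOfSingularities.ResolutionOfSingularities.Theorems.KeyChainLU
open Summit.ResolutionOfSingularities.ResolutionOfSingularities.Theorems.HenselKeyChainLU
open Summit.ResolutionOfSingularities.ResolutionOfSingularities.Theorems.GaloisDescentLU
open Summit.ResolutionOfSingularities.ResolutionOfSingularities.Theorems.PfaffLine
open Summit.ResolutionOfSingularities.ResolutionOfSingularities.Theorems.ToricLadder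
open Summit.ResolutionOfSingularities.ResolutionOfSingularities.Theorems.KaplanskyLadder
open Summit.ResolutionOfSingularities.ResolutionOfSingularities.Theorems.PerronLadder
open Summit.ResolutionOfSingularities.ResolutionOfSingularities.Theorems.DefectlessLadder
open Summit.ResolutionOfSingularities.ResolutionOfSingularities.Theorems.WCut

/-- **DECIDED PIECE** (tag DECIDED — a kernel THEOREM, `nonKHToricArchLUKeyHenselDescentQuotCell_holds`; WEAKER
than the root; located at `(e, c, n) = (3, 3, 4)`): the located residual of g23 (off the key-chain, Hensel and
descent cells) restricted to the TAME-QUOTIENT CELL. -/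
def NonKHToricArchLUKeyHenselDescentQuotCell (e c n : ℕ) : Prop :=
  ∀ p : ℕ, p.Prime → ∀ (k K : Type) [Field k] [CharP k p] [Field K] [Algebra k K],
    Algebra.trdeg k K ≤ n → ∀ O : ValuationSubring K, Nonempty O.valuation.RankOne →
    (∀ y ∈ O, ∃ f : Polynomial k, f ≠ 0 ∧ Polynomial.aeval y f ∈ O.nonunits) →
    ¬ IsAbhyankarPlace O (algebraMap k K).fieldRange ⊤ →
    ¬ (∃ d : ℕ, d < n ∧ SepDenseBelow k O d) → ¬ ToricDenseBelow k O e → ¬ KHTopBelow k O c →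
    ¬ KeyChainTopBelow k O → ¬ HenselKeyChainTopBelow k O → ¬ GaloisHenselDescentDatum k O →
    TameQuotientLU.TameEquivariantLUAbove k O → RelLocalUniformization k K O

/-- THE LAW DECIDES THE CELL PIECE outright, for all parameters (no port, no hypothesis, no `TheoremD`).
[folklore] -/
theorem nonKHToricArchLUKeyHenselDescentQuotCell_holds (e c n : ℕ) :
    NonKHToricArchLUKeyHenselDescentQuotCell e c n :=
  fun _ _ _ _ _ _ _ _ _ _ _ _ _ _ _ _ _ _ _ hT => relLU_of_tameEquivariantLUAbove hT

/-- **NEW LOCATED RESIDUAL** (tag UNDECIDED · WEAKER than the root · located at `(e, c, n) = (3, 3, 4)`): the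
located residual OFF the key-chain cell, OFF the Hensel cell, OFF the descent cell AND OFF the tame-quotient cell —
no tame cyclic Kummer top fixing a valuation ring above `O` carries `σ`-equivariant uniformization of the models
of `K`. -/
def NonKHToricArchLUKeyHenselDescentQuot (e c n : ℕ) : Prop :=
  ∀ p : ℕ, p.Prime → ∀ (k K : Type) [Field k] [CharP k p] [Field K] [Algebra k K],
    Algebra.trdeg k K ≤ n → ∀ O : ValuationSubring K, Nonempty O.valuation.RankOne →
    (∀ y ∈ O, ∃ f : Polynomial k, f ≠ 0 ∧ Polynomial.aeval y f ∈ O.nonunits) →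
    ¬ IsAbhyankarPlace O (algebraMap k K).fieldRange ⊤ →
    ¬ (∃ d : ℕ, d < n ∧ SepDenseBelow k O d) → ¬ ToricDenseBelow k O e → ¬ KHTopBelow k O c →
    ¬ KeyChainTopBelow k O → ¬ HenselKeyChainTopBelow k O → ¬ GaloisHenselDescentDatum k O →
    ¬ TameQuotientLU.TameEquivariantLUAbove k O → RelLocalUniformization k K O

/-- Dropping the extra negated hypothesis. [folklore] -/
theorem nonKHToricArchLUKeyHenselDescentQuot_of_descent {e c n : ℕ}
    (h : NonKHToricArchLUKeyHenselDescent e c n) : NonKHToricArchLUKeyHenselDescentQuot e c n :=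
  fun p hp k K _ _ _ _ hd O h1 h0 hA hnd hnt hnk hkey hH hG _ =>
    h p hp k K hd O h1 h0 hA hnd hnt hnk hkey hH hG

/-- **THE TAME-QUOTIENT CUT** (kernel, exact, hypothesis-free): the g23 located residual is EQUIVALENT to its
part off the tame-quotient cell — on the cell the law decides. [folklore] -/
theorem nonKHToricArchLUKeyHenselDescent_iff_quot {e c n : ℕ} :
    NonKHToricArchLUKeyHenselDescent e c n ↔ NonKHToricArchLUKeyHenselDescentQuot e c n := by
  refine ⟨nonKHToricArchLUKeyHenselDescentQuot_of_descent,
    fun h p hp k K _ _ _ _ hd O hr hz hA hnd hnt hnk hkey hH hG => ?_⟩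
  by_cases hT : TameQuotientLU.TameEquivariantLUAbove k O
  · exact relLU_of_tameEquivariantLUAbove hT
  · exact h p hp k K hd O hr hz hA hnd hnt hnk hkey hH hG hT

/-- The EXACT re-location at the programme's parameters `(3, 3, 4)` (the form named in the g25 window:
`R23 ↔ R25`, hypothesis-free). [folklore] -/
theorem nonKHToricArchLUKeyHenselDescent334_iff_quot :
    NonKHToricArchLUKeyHenselDescent 3 3 4 ↔ NonKHToricArchLUKeyHenselDescentQuot 3 3 4 :=
  nonKHToricArchLUKeyHenselDescent_iff_quot

/-- The TRUE residual family of g17/g20 (`NonKHToricArchLU`) re-located: off the key-chain, Hensel, descent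
and tame-quotient cells. [folklore] -/
theorem nonKHToricArchLU_iff_quot {e c n : ℕ} :
    NonKHToricArchLU e c n ↔ NonKHToricArchLUKeyHenselDescentQuot e c n :=
  nonKHToricArchLU_iff_descent.trans nonKHToricArchLUKeyHenselDescent_iff_quot

/-- The new residual follows from the root outright (it is a WEAKER piece). [folklore] -/
theorem nonKHToricArchLUKeyHenselDescentQuot_of_root (hS : _root_.ResolutionOfSingularities) (e c n : ℕ) :
    NonKHToricArchLUKeyHenselDescentQuot e c n :=
  nonKHToricArchLUKeyHenselDescentQuot_of_descent (nonKHToricArchLUKeyHenselDescent_of_root hS e c n)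

/-- **`closes_quot` — ROOT BY NAME (deciding theorem of this node).**  Cossart–Piltant floor (print) + CJS-2020
(named fact) + the KK05 (NC)+(V) ascent Π₁ (print) + the located residual OFF THE KEY-CHAIN, HENSEL, DESCENT AND
TAME-QUOTIENT CELLS in transcendence degree `≥ 4` + the patching crux 0642 ⇒ `ResolutionOfSingularities`; all
four cells are discharged INSIDE the kernel. [folklore] -/
theorem closes_quot (hCP : CossartPiltant2019LU3.{0}) (hCJS : CossartJannsenSaito2020Embedded.{0})
    (hAsc : KK05NCVAscent) (hN : ∀ d, 4 ≤ d → NonKHToricArchLUKeyHenselDescentQuot 3 3 d)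
    (h₃ : Valuative.PatchingRel) : _root_.ResolutionOfSingularities :=
  closes_descent hCP hCJS hAsc (fun d hd => nonKHToricArchLUKeyHenselDescent_iff_quot.2 (hN d hd)) h₃

/-- Root-level summary: modulo floor + CJS + Π₁ + 0642 the ROOT is EQUIVALENT to the residual family off the four
cells. [folklore] -/
theorem root_iff_quot_sigma (hCP : CossartPiltant2019LU3.{0})
    (hCJS : CossartJannsenSaito2020Embedded.{0}) (hAsc : KK05NCVAscent) (h₃ : Valuative.PatchingRel) :
    _root_.ResolutionOfSingularities ↔ ∀ d, 4 ≤ d → NonKHToricArchLUKeyHenselDescentQuot 3 3 d := by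
  rw [root_iff_descent_sigma hCP hCJS hAsc h₃]
  exact forall₂_congr fun d _ => nonKHToricArchLUKeyHenselDescent_iff_quot

end Cut

end Summit.ResolutionOfSingularities.ResolutionOfSingularities.Theorems.TameQuotientLU

end
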